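import Summits.Langlands.Langlands.Theses.IrreducibilityBySelfDuality
import Summits.Langlands.Langlands.Theorems.IrreducibilityBySelfDualityIrreducibleOffSectorTransfer
import Summits.Langlands.Langlands.Theorems.IrreducibleOffSector.Negative.FalseWithoutPos

/-!
# Disproof of `IrreducibleOffSector` (crux stmt-Langlands-14329, route `IrreducibilityBySelfDuality`,
# line `Sketch`) — findings of the standing disprover (cycle 1, 2026-08-16)

VERDICT SO FAR: **no kill; the crux resists.** It is Ramakrishnan's "cuspidal ⇒ irreducible"
expectation (arXiv:math/0609460 §0) for every `n ≥ 1`, every number field `K`, every L-algebraic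
cuspidal `π` off the sector `n = 3 ∧ K CM ∧ regular`, every `ℓ, ι` and every a.e.-compatible
`ρ` — an open component of the summit. PRINTED STATUS (read this cycle, `lit read
arxiv:math/0609460`): Ramakrishnan, *Irreducibility and Cuspidality* (2007), p. 3 L78–82: "A natural
question … is to ask if π is cuspidal when ρ_ℓ is irreducible, and vice-versa. It is certainly what is
predicted by the general philosophy. However, proving it is another matter altogether, and positive
evidence is scarce beyond n = 2"; Question 1.4.3 (p. 8 L108). No counterexample for GL_n is in print
(CAP phenomena live on other groups); `lit search` 2026-08-16 degraded (local FTS down, OpenAlex/S2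
429) — zbMATH/crossref hits: Hui 2023 (jlms.12811), Zenteno arXiv:2306.02493, none negative.
Index of what this file records (prose only in docstrings):

1. `¬ crux ⇒ ¬ Langlands` (`not_langlands_of_not_crux`, from the prover's
   `isIrreducible_of_langlands`, p79199): a refutation of the crux at any `n ≥ 1` refutes the
   audited summit statement itself, so a JUNK-MODEL kill of the crux would have to be a junk model
   of `Langlands` — none exists by the statement audit (conjunctive `SatakeFrobCompatibleAt`,
   genuine `CuspidalAutomorphicRepData`), and none was found here (§ Junk ledger below).
2. LOAD-BEARING `0 < n`: LANDED as `Negative.irreducibleOffSector_false_without_pos` (p100603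
   ACCEPTED d0c82994, imported): the unguarded text is false by the junk cuspidal datum `ℂ·1/⊥` of `GL_0(𝔸_ℚ)`
   (constant `1` is an automorphic form on `GL_n` for all `n`; Satake `∅` everywhere; L-algebraic
   via `U(𝔤𝔩₀) = ℝ`) and the trivial rank-0 `ρ` (compatible, not irreducible). Re-exported below.
3. BOUNDARY `n = 1`: the crux is TRUE in rank one for every `K, π, ι, ρ` (prover's
   `isIrreducible_of_rank_one`; restated as the slice `crux_rank_one`), so the first contentful
   rank is `n = 2` (open already for `K = ℚ` and IRREGULAR `π`: weight-one / Maass-type forms have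
   Galois representations only in the holomorphic limit-of-discrete-series case).
4. OTHER HYPOTHESES (mutation on paper; no Lean test is possible because no inhabitant of
   `CuspidalAutomorphicRepData n K hcpt` with `n ≥ 2` is constructible in the tree — every field of
   `AutomorphicRepData`/`IsAutomorphicForm`/`cuspFormsGL`/`HasSatakeParamAt` is genuine):
   * CUSPIDAL: load-bearing in substance — an isobaric `χ₁ ⊞ χ₂` on `GL_2` has the reducible
     compatible `ρ = ρ_{χ₁} ⊕ ρ_{χ₂}`; not expressible here (no isobaric/Eisenstein datum type with
     Satake parameters in the cone; `CuspidalAutomorphicRepData` is the only carrier).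
   * `IsLAlgebraic`: used by the line (E = `ReciprocityUpToIrreducibility` only produces `ρ` for
     L-algebraic `π`); for non-algebraic `π` compatible `ρ` should not exist for tame `ι`, but the
     ideator's WILD-ι note (Cruxes/…/NOTES-r1-k2.md §3) shows transcendental Frobenius data can be
     matched by a wild `ι`, so dropping it is NOT known to be harmless. Untestable here.
   * `∀ᶠ v in cofinite` compatibility: weakening to `∃ᶠ` (infinitely many `v`) is false in
     substance for `n ≥ 2` (twist `ρ` by a quadratic character: agreement on a density-½ set) —
     untestable here for want of an inhabitant; in rank 1 every variant stays true.
   * OFF-SECTOR clause: only SHRINKS the domain; dropping it gives the full conjecture (the sector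
     is the route's theorem T = `IrreducibleGL3CM.frame_proof`, proved as an implication).
5. LINE `Sketch` (lead prover-line-stmt-Langlands-14329-0; skeleton sha 6070de8c; stubs
   `stub_reciprocity` = E by name, `stub_jsInputs`, `stub_isobaricRigidity` (K1),
   `stub_frameDevissage` (LANDED p97031), `stub_deRhamBlocks`, `stub_constituentsAssembly`
   (LANDED p97213)). Attacked this cycle:
   * K1 `stub_isobaricRigidity` — TRUE as stated (Jacquet–Shalika 1981 II Thm 4.4; the case
     `Σ m_i ≠ n` holds by cardinality GIVEN `hasSatakeParamAt_cofinite_holds` and the infinitude of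
     places — the lead must invoke a.e.-unramifiedness of `π` there, the card mismatch alone does
     not contradict `∀ᶠ` on an empty set of unramified places). Its guards ARE load-bearing:
     without `∀ i, 0 < m i` a junk `GL_0` block pads any decomposition (`t_π = ∅ + t_π`), without
     `2 ≤ k` the one-block identity decomposes `π` by itself — both LANDED sorry-free as
     `Negative.isobaricRigidity_false_without_blockPos` / `Negative.isobaricRigidity_false_without_two_le`
     (Negative/IsobaricRigidityGuards.lean, p102962 ACCEPTED bc8beb1f; it reuses the `GL_0` witness; this
     v1.1 keeps local copies in §5, v2 will import the module). NOT a stub refutation.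
     The TRUE complement is proved too (`isobaricRigidity_of_card_ne`, §5b): if `Σ m_i ≠ n` the
     eventual decomposition fails for EVERY datum `π`, by a.e.-unramifiedness + `card = rank` — so
     the lead's K1 reduces at once to `Σ m_i = n` (the genuine Jacquet–Shalika case).
   * `stub_deRhamBlocks` (de Rham-ness of the diagonal blocks of a block-triangular conjugate, for
     an ARBITRARY `PstWeilDeligneData`): TRUE for every datum, not only the pinned Fontaine datum —
     `IsDeRhamFramed` is Fontaine admissibility of a `ℚ_ℓ`-model for the datum's `PeriodRingData`,
     whose regularity fields give closure under sub-objects and quotients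
     (`PeriodRingData.isAdmissible_of_shortExact`, `isAdmissible_pi_iff`); the only friction is the
     MODEL (`HasQlModel`): enlarge `E` to contain the entries of the conjugating matrix `P` (finitely
     many algebraic elements of `ℚ̄_ℓ`) and compare through `isAdmissible_restrictScalars_of_le`.
     No junk datum breaks it: the structure `PstWeilDeligneData` constrains `IsWeilDeligneOf`, not
     `𝔅`, but admissibility closure needs only `PeriodRingData`'s own axioms. Not refutable.
   * `stub_frameDevissage`, `stub_constituentsAssembly`: landed (true). `stub_jsInputs`: three
     printed inputs (formalization debt). `stub_reciprocity` = E: open problem, not attacked.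
   * JOINT SUFFICIENCY: `collapse : IsobaricRigidity → GeometricConstituents →
     ReciprocityUpToIrreducibility → IrreducibleOffSector` is kernel-checked (ideator Sketch.lean
     rev 2, axioms standard) — `IrreducibleOffSector_of` smuggles no gap; the line's honest open
     content is E + K1 + the `JacquetShalika1981_partialPairL_pole_repData` input.
6. NATURAL STRENGTHENINGS refuted: allowing `n = 0` (item 2). Strengthenings NOT refutable here
   (no inhabitant): absolute irreducibility (same over `ℚ̄_ℓ`), compatibility at a density-one set,
   dropping L-algebraicity.
7. NEAR-MISSES / TARGETS: payload `targets`/`stuck_stubs` empty this cycle; nothing sorried.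

WHY IT RESISTS (for the provers): every avenue to `¬ crux` needs a cuspidal `π` on `GL_n`,
`n ≥ 2`, with a reducible compatible `ρ`; genuine ones are the open problem and junk ones do not
exist in this tree (the datum carries actual cusp forms, Hecke eigen-relations modulo `W'`, and a
Harish-Chandra parameter; compatibility is an `∃ α ∧ unramified ∧ charpoly` conjunction; `ι` and
`hcpt` exist). The disprover's only lever is degenerate ranks, now exhausted (`n = 0` false,
`n = 1` true).
-/

noncomputable section

-- `Summit.Langlands.Langlands.…` (summit = sub-problem name, D-0017 layout) trips `dupNamespace`.
set_option linter.dupNamespace false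

open scoped NumberField Classical
open Filter IsDedekindDomain
open Literature.NumberTheory.Automorphic Literature.NumberTheory.GaloisRepresentations
open Summit.Langlands
open Summit.Langlands.Langlands.Theses.IrreducibilityBySelfDuality

namespace Summit.Langlands.Langlands.Cruxes.IrreducibleOffSector.Disproof

/-! ## 0. The crux elaborates (probe) -/

/-- The crux, by name (elaboration probe; open). [folklore] -/
example : Prop := IrreducibleOffSector

/-! ## 1. A kill of the crux is a kill of the summit -/

/-- **`¬ IrreducibleOffSector → ¬ Langlands`**: the summit's clause (A) gives an irreducible
corresponding `ρ₀`; any a.e.-compatible `ρ` shares its Frobenius polynomials a.e., hence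
(Chebotarev + Brauer–Nesbitt, prover's `isIrreducible_of_langlands`, p79199) is irreducible. So a
junk-model refutation of the crux would be a junk model of the audited summit statement.
[folklore] -/
theorem not_langlands_of_not_crux (h : ¬ IrreducibleOffSector) : ¬ _root_.Langlands := fun hL =>
  h fun _n _K _ _ hcpt hn π hLalg _ ℓ _ ι ρ hρ =>
    Summit.Langlands.Langlands.Theorems.IrreducibleOffSector.isIrreducible_of_langlands hL hn hcpt π
      hLalg ℓ ι ρ hρ

/-! ## 2. Load-bearing analysis: the guard `0 < n` (LANDED, p100603) -/

/-- **The crux without `0 < n` is false** (re-export of the landed negative lemma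
`Negative.irreducibleOffSector_false_without_pos`: junk cuspidal `GL_0` datum `ℂ·1/⊥` over `ℚ`,
Satake `∅` everywhere, L-algebraic; trivial rank-0 `ρ` compatible and not irreducible). [folklore] -/
theorem irreducibleOffSector_false_without_pos :
    ¬ (∀ (n : ℕ) (K : Type) [Field K] [NumberField K]
        (hcpt : Literature.NumberTheory.Automorphic.isCompact_glFiniteIntegralLevel n K),
        ∀ (π : Literature.NumberTheory.Automorphic.CuspidalAutomorphicRepData n K hcpt),
          π.1.IsLAlgebraic →
          ¬ (n = 3 ∧ NumberField.IsCMField K ∧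
              ∃ T : Literature.NumberTheory.Automorphic.InfinityType K n,
                π.1.HasInfinityType T ∧ T.IsRegular) →
          ∀ (ℓ : ℕ) [Fact ℓ.Prime] (ι : PadicAlgCl ℓ ≃+* ℂ)
            (ρ : Literature.NumberTheory.GaloisRepresentations.FramedGaloisRep K (PadicAlgCl ℓ) n),
            (∀ᶠ v : IsDedekindDomain.HeightOneSpectrum (NumberField.RingOfIntegers K) in cofinite,
              SatakeFrobCompatibleAt ι π.1 ρ v) →
            ρ.toGaloisRep.IsIrreducible) :=
  Summit.Langlands.Langlands.Theorems.IrreducibleOffSector.Negative.irreducibleOffSector_false_without_pos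

/-- The junk witness behind item 2, for re-use by ideators: over EVERY number field the rank-0
cuspidal datum `ℂ·1/⊥` exists, is L-algebraic and has Satake parameter `∅` at every place.
[folklore] -/
theorem exists_junk_cuspidal_rank_zero (K : Type) [Field K] [NumberField K]
    (hcpt : isCompact_glFiniteIntegralLevel 0 K) :
    ∃ π : CuspidalAutomorphicRepData 0 K hcpt,
      π.1.IsLAlgebraic ∧ ∀ v : HeightOneSpectrum (𝓞 K), π.1.HasSatakeParamAt v ∅ := by
  obtain ⟨π, hW, hW'⟩ :=
    Summit.Langlands.Langlands.Theorems.IrreducibleOffSector.Negative.exists_trivialCuspidalZero hcpt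
  exact ⟨π, Summit.Langlands.Langlands.Theorems.IrreducibleOffSector.Negative.isLAlgebraic_of_W_eq
    hcpt π.1 hW, fun v =>
    Summit.Langlands.Langlands.Theorems.IrreducibleOffSector.Negative.hasSatakeParamAt_empty_of_W_eq
      hcpt π.1 hW hW' v⟩

/-! ## 3. Boundary: the rank-one slice of the crux is true -/

/-- **The crux holds in rank `n = 1`** for every `K`, `π`, `ℓ`, `ι`, `ρ` — with no use of the
hypotheses at all (a line is a simple module; prover's `isIrreducible_of_rank_one`). So cuspidality,
L-algebraicity and compatibility only start to bite at `n = 2`. [folklore] -/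
theorem crux_rank_one (K : Type) [Field K] [NumberField K]
    (hcpt : isCompact_glFiniteIntegralLevel 1 K) (π : CuspidalAutomorphicRepData 1 K hcpt)
    (ℓ : ℕ) [Fact ℓ.Prime] (ι : PadicAlgCl ℓ ≃+* ℂ) (ρ : FramedGaloisRep K (PadicAlgCl ℓ) 1)
    (_hρ : ∀ᶠ v : HeightOneSpectrum (𝓞 K) in cofinite, SatakeFrobCompatibleAt ι π.1 ρ v) :
    ρ.toGaloisRep.IsIrreducible :=
  Summit.Langlands.Langlands.Theorems.IrreducibleOffSector.isIrreducible_of_rank_one ρ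

/-! ## 5. Line `Sketch`: guards of the isobaric-rigidity stub K1

LANDED as `Negative/IsobaricRigidityGuards.lean` (p102962; local copies kept below until the farm
has built that module — v2 imports it). Statements (the proposition negated is the CONSEQUENT of `stub_isobaricRigidity` with one
guard deleted, everything else verbatim):

* `isobaricRigidity_false_without_blockPos` — drop `∀ i, 0 < m i`: witness `K = ℚ`, `n = 1`,
  `π = ℂ·1/⊥` on `GL_1`, `k = 2`, blocks of ranks `(0, 1)` = (junk `GL_0` datum, `π`),
  `β = (∅, t_{π,v})` at every place.
* `isobaricRigidity_false_without_two_le` — drop `2 ≤ k`: `k = 1`, the block `π` itself.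
-/

/-- Rank-one inhabitant used by the K1 guard witnesses: the trivial character datum `ℂ·1/⊥` of
`GL_1(𝔸_K)` is cuspidal (cusp conditions `0 < k < 1` are empty). [folklore] -/
theorem exists_trivialCuspidalOne (K : Type) [Field K] [NumberField K]
    (hcpt : isCompact_glFiniteIntegralLevel 1 K) :
    ∃ π : CuspidalAutomorphicRepData 1 K hcpt,
      π.1.W = Submodule.span ℂ {fun _ : (AdelicGroupData.gl 1 K).Adelic => (1 : ℂ)} ∧
        π.1.W' = ⊥ := by
  obtain ⟨π, hW, hW'⟩ :=
    Summit.Langlands.Langlands.Theorems.IrreducibleOffSector.Negative.exists_trivialRepData hcpt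
  refine ⟨⟨π, ?_⟩, hW, hW'⟩
  rw [hW]
  exact Submodule.span_le.2 (by
    rintro _ rfl
    exact Submodule.subset_span
      ⟨Summit.Langlands.Langlands.Theorems.IrreducibleOffSector.Negative.isAutomorphicForm_constOne
        hcpt, fun k hk hk1 => absurd hk1 (by omega)⟩)

/-- **K1 without the block guard `∀ i, 0 < m i` is false** (junk `GL_0` block). [folklore] -/
theorem isobaricRigidity_false_without_blockPos :
    ¬ (∀ (K : Type) [Field K] [NumberField K] (n : ℕ)
        (hcpt : isCompact_glFiniteIntegralLevel n K), 0 < n →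
        ∀ (π : CuspidalAutomorphicRepData n K hcpt) (k : ℕ) (m : Fin k → ℕ)
          (hm : ∀ i, isCompact_glFiniteIntegralLevel (m i) K)
          (σ : ∀ i, CuspidalAutomorphicRepData (m i) K (hm i)), 2 ≤ k →
          ¬ ∀ᶠ v : HeightOneSpectrum (𝓞 K) in cofinite, ∀ α : Multiset ℂ,
              π.1.HasSatakeParamAt v α →
                ∃ β : Fin k → Multiset ℂ, (∀ i, (σ i).1.HasSatakeParamAt v (β i)) ∧
                  α = ∑ i, β i) := by
  intro h
  have hc : ∀ j, isCompact_glFiniteIntegralLevel j ℚ := fun j => isCompact_glFiniteIntegralLevel_holds j ℚ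
  obtain ⟨π₀, hW₀, hW₀'⟩ :=
    Summit.Langlands.Langlands.Theorems.IrreducibleOffSector.Negative.exists_trivialCuspidalZero (hc 0)
  obtain ⟨π₁, -, -⟩ := exists_trivialCuspidalOne ℚ (hc 1)
  let m : Fin 2 → ℕ := fun i => (i : ℕ)
  let σ : ∀ i : Fin 2, CuspidalAutomorphicRepData (m i) ℚ (hc (m i)) :=
    Fin.cons π₀ (Fin.cons π₁ finZeroElim)
  refine h ℚ 1 (hc 1) one_pos π₁ 2 m (fun i => hc (m i)) σ le_rfl
    (Filter.Eventually.of_forall fun v α hα => ⟨![∅, α], ?_, by simp⟩)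
  refine Fin.forall_fin_two.2 ⟨?_, ?_⟩
  · exact Summit.Langlands.Langlands.Theorems.IrreducibleOffSector.Negative.hasSatakeParamAt_empty_of_W_eq
      (hc 0) π₀.1 hW₀ hW₀' v
  · exact hα

/-- **K1 without `2 ≤ k` is false** (one block: `π` itself). [folklore] -/
theorem isobaricRigidity_false_without_two_le :
    ¬ (∀ (K : Type) [Field K] [NumberField K] (n : ℕ)
        (hcpt : isCompact_glFiniteIntegralLevel n K), 0 < n →
        ∀ (π : CuspidalAutomorphicRepData n K hcpt) (k : ℕ) (m : Fin k → ℕ)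
          (hm : ∀ i, isCompact_glFiniteIntegralLevel (m i) K)
          (σ : ∀ i, CuspidalAutomorphicRepData (m i) K (hm i)), (∀ i, 0 < m i) →
          ¬ ∀ᶠ v : HeightOneSpectrum (𝓞 K) in cofinite, ∀ α : Multiset ℂ,
              π.1.HasSatakeParamAt v α →
                ∃ β : Fin k → Multiset ℂ, (∀ i, (σ i).1.HasSatakeParamAt v (β i)) ∧
                  α = ∑ i, β i) := by
  intro h
  have hc : isCompact_glFiniteIntegralLevel 1 ℚ := isCompact_glFiniteIntegralLevel_holds 1 ℚ
  obtain ⟨π₁, -, -⟩ := exists_trivialCuspidalOne ℚ hc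
  exact h ℚ 1 hc one_pos π₁ 1 (fun _ => 1) (fun _ => hc) (fun _ => π₁) (fun _ => one_pos)
    (Filter.Eventually.of_forall fun v α hα => ⟨fun _ => α, fun _ => hα, by simp⟩)


/-! ## 5b. The true complement of the K1 guards: the cardinality case (positive helper for the lead) -/

/-- **K1, cardinality case** (the part of `stub_isobaricRigidity` that the guards do not touch
and that needs no L-function input): if `Σ m_i ≠ n`, NO datum `π` on `GL_n` — cuspidal or not,
any `n` — is almost everywhere the sum of Satake parameters of blocks of ranks `m_i`, because `π`
is unramified at all but finitely many of the infinitely many finite places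
(`hasSatakeParamAt_cofinite_holds`, `infinite_heightOneSpectrum`) and Satake parameters have
`card = rank` (`HasSatakeParamAt.card_eq`, `Multiset.card_sum`). So the lead's K1 proof may
reduce at once to `Σ m_i = n`, where the Jacquet–Shalika pole/non-vanishing argument lives.
Flath 1979, Thm. 3 (a.e. unramified). [folklore] -/
theorem isobaricRigidity_of_card_ne {K : Type} [Field K] [NumberField K] {n : ℕ}
    {hcpt : isCompact_glFiniteIntegralLevel n K} (π : CuspidalAutomorphicRepData n K hcpt)
    {k : ℕ} {m : Fin k → ℕ} {hm : ∀ i, isCompact_glFiniteIntegralLevel (m i) K}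
    (σ : ∀ i, CuspidalAutomorphicRepData (m i) K (hm i)) (hne : ∑ i, m i ≠ n) :
    ¬ ∀ᶠ v : HeightOneSpectrum (𝓞 K) in cofinite, ∀ α : Multiset ℂ, π.1.HasSatakeParamAt v α →
        ∃ β : Fin k → Multiset ℂ, (∀ i, (σ i).1.HasSatakeParamAt v (β i)) ∧ α = ∑ i, β i := by
  intro h
  haveI : Infinite (HeightOneSpectrum (𝓞 K)) := infinite_heightOneSpectrum K
  obtain ⟨v, ⟨α, hα⟩, hv⟩ :=
    ((AutomorphicRepData.hasSatakeParamAt_cofinite_holds π.1).and h).exists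
  obtain ⟨β, hβ, rfl⟩ := hv α hα
  apply hne
  have hcard := hα.card_eq
  rw [Multiset.card_sum] at hcard
  rw [← hcard]
  exact Finset.sum_congr rfl fun i _ => ((hβ i).card_eq).symm

/-! ## Junk ledger (attacks that cannot even be typed, and why)

* A junk `π : CuspidalAutomorphicRepData n K hcpt`, `n ≥ 2`, with prescribed Satake parameters:
  needs a non-zero CUSP form; the constant `1` (the only form constructible here,
  `Negative.isAutomorphicForm_constOne`) fails `CuspConditionGL` for `0 < k < n` as soon as
  `n ≥ 2` (its constant term is itself), and its Hecke eigenvalues are the DEGREES of `T_{v,i}`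
  (Satake parameter `{q^{(n-1)/2}, …, q^{-(n-1)/2}}`), matching no Galois representation through
  `arithFrobPolyOfSatake ι q 1` anyway (half-integral Tate twists for even `n`).
* Vacuous compatibility: impossible, `SatakeFrobCompatibleAt` is `∃ α, HasSatakeParamAt ∧ …`.
* Non-existence of `ι`: `PadicAlgCl.nonempty_ringEquiv_complex` (proved).
* `hcpt`: `isCompact_glFiniteIntegralLevel_holds` (proved), so no escape through the level.
* Rank 1: true (item 3). Rank 0: excluded by the guard (item 2).
-/

end Summit.Langlands.Langlands.Cruxes.IrreducibleOffSector.Disproof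

end
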